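import Literature.AlgebraicGeometry.Frobenioids.GroupLikeStandardExample
import Literature.AlgebraicGeometry.Frobenioids.DilatingMonoidExample
import Literature.AlgebraicGeometry.Frobenioids.ElementaryFrobeniusCompact
import Literature.AlgebraicGeometry.Frobenioids.IrreducibleMorphismsCounterexample
import Literature.AlgebraicGeometry.Frobenioids.ArithmeticFrobenioidIsotropic
import Mathlib.Tactic.Group
import HarnessLib

/-!
# Frobenioids I, Examples 3.6 and 3.7: the Frobenioid-level claims PROVED

Mochizuki, *The geometry of Frobenioids I: the general theory*, Kyushu J. Math. **62** (2008)
293–400, kurims text pp. 70–71 [cite: MochizukiFrdI2008, Ex. 3.6 p.70] [cite: MochizukiFrdI2008, Ex. 3.7 pp.70-71].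
PROOF-ONLY companion of `GroupLikeStandardExample.lean` / `DilatingMonoidExample.lean` (seat
abc-iut-L1-t8), whose module docstrings deferred the claims below until [FrdI] Def. 1.2/1.3/3.1 landed
(found's `ElemFrobenioid.toChar`, `isFrobenioid_toChar` = Prop. 1.5 (i); seat abc-iut-L1-t3's
`PreFrobenioidData.IsOfStandardType` = Def. 3.1 (i)). As in those files, "`C`" is the elementary Frobenioid
`F_Φ → F_{Φ^char}` of the respective monoid `Φ` on the one-object category `D` of `F_G`,
`G = ℤ ⊕ ⨁_p ℤ/pℤ` (Ex. 3.6: `Φ ≡ G` with trivial action, `End ≅ F_G × F_G` = `Ex36.identification`;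
Ex. 3.7: `Φ = G × ℤ_{≥0}`, `f` acting by `d_f` on `ℤ_{≥0}`).

PROVED (Ex. 3.6, p. 70): "`C` is a Frobenioid of Frobenius-normalized, isotropic, and group-like type
[cf. Proposition 1.5, (i), (iii)]" (`Ex36.isFrobenioid`, `Ex36.isOfType_isFrobeniusNormalized`,
`Ex36.isOfIsotropicType`, `Ex36.isOfType_isGroupLikeObj`); "since `G^pf ≅ ℚ ≠ 0`, and the first factor of
`F_G` … commutes with the `G` [i.e., '`O^×(−)`'] of the second factor …, the unique object of `C` is
Frobenius-compact" (`Ex36.isFrobeniusCompact`); "Thus, `C` is of standard type" (`Ex36.isOfStandardType`).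
PROVED (Ex. 3.7, pp. 70–71): "`C` is a Frobenioid of Frobenius-normalized and isotropic type, which is not
of group-like type [cf. Proposition 1.5, (i), (ii)]" (`Ex37.isFrobenioid`, `Ex37.isOfType_isFrobeniusNormalized`,
`Ex37.isOfIsotropicType`, `Ex37.not_isOfType_isGroupLikeObj`); the monoid axioms of Def. 1.1 (ii) for the
dilating `Φ` (`Ex37.isMonoidOn_Φ`). Not repeated: the items already proved or refuted in the statement files
(slimness, FSM-type, the factor switches, the printed endomorphism law).
No statement of the paper is strengthened; nothing here takes a side on [IUTchIII] Cor. 3.12.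
-/

namespace Literature.AlgebraicGeometry.Frobenioids

open CategoryTheory Opposite

/-! ### Example 3.6 -/

namespace Ex36

/-- `Φ ≡ G` (trivial action) is a monoid on `D`: its pull-back maps are identities.
[cite: MochizukiFrdI2008, Ex. 3.6 p.70] -/
theorem isMonoidOn_Φ : IsMonoidOn Literature.AlgebraicGeometry.Frobenioids.Ex36.Φ :=
  isMonoidOn_of_bijective fun _ => ⟨fun _ _ h => h, fun y => ⟨y, rfl⟩⟩

/-- `Φ ≡ G` is (objectwise) group-like, in particular pre-divisorial (`G` is an abelian group).
[cite: MochizukiFrdI2008, Ex. 3.6 p.70] -/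
theorem objectwise_isGroupLike_Φ : Objectwise (fun N _ => IsGroupLike N) Literature.AlgebraicGeometry.Frobenioids.Ex36.Φ :=
  fun _ => isGroupLike_of_commGroup (Multiplicative G)

/-- **Example 3.6**: "`C` is a Frobenioid" — `F_Φ → F_{Φ^char}` is a Frobenioid (Prop. 1.5 (i): `Φ` is a
pre-divisorial monoid on the connected, totally epimorphic one-object category `D` of `F_G`).
[cite: MochizukiFrdI2008, Ex. 3.6 p.70] -/
theorem isFrobenioid : PreFrobenioid.IsFrobenioid (ElemFrobenioid.toChar Literature.AlgebraicGeometry.Frobenioids.Ex36.Φ) :=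
  ElemFrobenioid.isFrobenioid_toChar isMonoidOn_Φ (fun X => (objectwise_isGroupLike_Φ X).isPreDivisorial)
    (isGraphConnected_singleObj FG) (isTotallyEpimorphic_singleObj_elemFrobenioidMonoid (Multiplicative G))

/-- **Example 3.6**: "… of Frobenius-normalized … type" (Prop. 1.5 (i)). [cite: MochizukiFrdI2008, Ex. 3.6 p.70] -/
theorem isOfType_isFrobeniusNormalized :
    PreFrobenioid.IsOfType (PreFrobenioid.IsFrobeniusNormalized (ElemFrobenioid.toChar Literature.AlgebraicGeometry.Frobenioids.Ex36.Φ)) :=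
  fun A => ElemFrobenioid.isFrobeniusNormalized A

/-- **Example 3.6**: "… isotropic … type" (Prop. 1.5 (i)). [cite: MochizukiFrdI2008, Ex. 3.6 p.70] -/
theorem isOfIsotropicType : PreFrobenioid.IsOfIsotropicType (ElemFrobenioid.toChar Literature.AlgebraicGeometry.Frobenioids.Ex36.Φ) :=
  fun A => ElemFrobenioid.isIsotropic A

/-- **Example 3.6**: "… and group-like type [cf. Proposition 1.5, (i), (iii)]" (`Φ ≡ G` is group-like).
[cite: MochizukiFrdI2008, Ex. 3.6 p.70] -/
theorem isOfType_isGroupLikeObj :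
    PreFrobenioid.IsOfType (PreFrobenioid.IsGroupLikeObj (ElemFrobenioid.toChar Literature.AlgebraicGeometry.Frobenioids.Ex36.Φ)) :=
  ElemFrobenioid.isOfType_isGroupLikeObj objectwise_isGroupLike_Φ

/-- The element `(1, 0) ∈ G = ℤ ⊕ ⨁_p ℤ/pℤ` has infinite order ("`G^pf ≅ ℚ ≠ 0`").
[cite: MochizukiFrdI2008, Ex. 3.6 p.70] -/
theorem nsmul_one_zero_ne_zero {N : ℕ} (hN : 0 < N) : N • ((1, 0) : Literature.AlgebraicGeometry.Frobenioids.Ex36.G) ≠ 0 := by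
  intro h
  have h1 := congrArg Prod.fst h
  simp only [Prod.smul_fst, Prod.fst_zero, nsmul_eq_mul, mul_one] at h1
  omega

/-- **Example 3.6**: "since `G^pf ≅ ℚ ≠ 0`, and the first factor of `F_G` in the product `F_G × F_G` commutes
with the `G` [i.e., '`O^×(−)`'] of the second factor of `F_G`, it follows that the unique object of `C` is
Frobenius-compact" (FrdI p. 70; PROVED for the unique object of `F_Φ → F_{Φ^char}`: `O^× ≅ G` has the element
`(1, 0)` of infinite order, and `Aut` acts trivially on `O^×` because all pull-backs of `Φ` are identities).
[cite: MochizukiFrdI2008, Ex. 3.6 p.70] -/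
theorem isFrobeniusCompact :
    (PreFrobenioidData.ofFunctor (charFunctor Literature.AlgebraicGeometry.Frobenioids.Ex36.Φ) (ElemFrobenioid.toChar Literature.AlgebraicGeometry.Frobenioids.Ex36.Φ)).IsFrobeniusCompact
      (trivObj Literature.AlgebraicGeometry.Frobenioids.Ex36.FG (Multiplicative Literature.AlgebraicGeometry.Frobenioids.Ex36.G)) := by
  refine ElemFrobenioid.isFrobeniusCompact_of _ ⟨toUnits (Multiplicative.ofAdd ((1, 0) : G)), fun N hN h => ?_⟩
    fun β p q _ _ c => ⟨1, Nat.one_pos, ?_⟩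
  · have h' := congrArg Units.val h
    rw [Units.val_pow_eq_pow_val, Units.val_one] at h'
    change (Multiplicative.ofAdd ((1, 0) : G)) ^ N = 1 at h'
    rw [← ofAdd_nsmul, ← ofAdd_zero] at h'
    exact nsmul_one_zero_ne_zero hN (Multiplicative.ofAdd.injective h')
  · rw [show Units.map (pull Φ β) c = c from Units.ext rfl]

/-- **Example 3.6**: "Thus, `C` is of standard type" (FrdI p. 70; Def. 3.1 (i): (a), (c) by Prop. 1.5 (i); (b) the
Frobenius-compact unique object; (d) "`D` is of FSM-, hence also of FSMFF-type" (`Ex36.isOfFSMFFType`); (e)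
`Φ^char = 0` is non-dilating) — PROVED for `F_Φ → F_{Φ^char}`. [cite: MochizukiFrdI2008, Ex. 3.6 p.70] -/
theorem isOfStandardType :
    (PreFrobenioidData.ofFunctor (charFunctor Literature.AlgebraicGeometry.Frobenioids.Ex36.Φ) (ElemFrobenioid.toChar Literature.AlgebraicGeometry.Frobenioids.Ex36.Φ)).IsOfStandardType := by
  haveI : Subsingleton (Associates (Multiplicative G)) := (isGroupLike_of_commGroup (Multiplicative G)).subsingleton_associates
  refine ElemFrobenioid.isOfStandardType_toChar_of isMonoidOn_Φ
    (fun X => (objectwise_isGroupLike_Φ X).isPreDivisorial) (isGraphConnected_singleObj FG)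
    (isTotallyEpimorphic_singleObj_elemFrobenioidMonoid (Multiplicative G)) (fun _ => ⟨_, isFrobeniusCompact⟩)
    isOfFSMFFType ⟨fun X f _ a => ?_⟩
  have : Subsingleton
      (Associates ((PreFrobenioidData.ofFunctor (charFunctor Φ) (ElemFrobenioid.toChar Φ)).Mon X)) := by
    change Subsingleton (Associates (Associates (Multiplicative G)))
    infer_instance
  exact Subsingleton.elim _ _

end Ex36

/-! ### Example 3.7 -/

namespace Ex37

open Ex36 (G FG D)

/-- Values of `act`. [cite: MochizukiFrdI2008, Ex. 3.7 p.70] -/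
theorem act_apply (f : FG) (x : Multiplicative G × Multiplicative ℕ) :
    Literature.AlgebraicGeometry.Frobenioids.Ex37.act f x = (x.1, x.2 ^ (f.degFr : ℕ)) := rfl

/-- In `(ℤ_{≥0}, +)` (multiplicatively written) the power maps `a ↦ a^d`, `d ≥ 1`, are injective.
[cite: MochizukiFrdI2008, Ex. 3.7 p.70] -/
theorem pow_injective_multiplicativeNat (d : ℕ+) :
    Function.Injective fun a : Multiplicative ℕ => a ^ (d : ℕ) := by
  intro a b h
  have h' : (d : ℕ) * a.toAdd = (d : ℕ) * b.toAdd := by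
    have := congrArg Multiplicative.toAdd h
    simpa [toAdd_pow] using this
  exact Multiplicative.toAdd.injective (Nat.eq_of_mul_eq_mul_left d.pos h')

/-- `act f` is injective. [cite: MochizukiFrdI2008, Ex. 3.7 p.70] -/
theorem act_injective' (f : FG) : Function.Injective (Literature.AlgebraicGeometry.Frobenioids.Ex37.act f) := by
  intro x y h
  rw [act_apply, act_apply, Prod.mk.injEq] at h
  exact Prod.ext h.1 (pow_injective_multiplicativeNat f.degFr h.2)

/-- A unit of `G × ℤ_{≥0}` has trivial `ℤ_{≥0}`-component. [cite: MochizukiFrdI2008, Ex. 3.7 p.70] -/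
theorem snd_eq_one_of_isUnit {x : Multiplicative Literature.AlgebraicGeometry.Frobenioids.Ex36.G × Multiplicative ℕ} (hx : IsUnit x) : x.2 = 1 := by
  obtain ⟨u, rfl⟩ := hx
  have h : (u : Multiplicative G × Multiplicative ℕ).2 * (↑u⁻¹ : Multiplicative G × Multiplicative ℕ).2 = 1 := by
    rw [← Prod.snd_mul, Units.mul_inv]; rfl
  have h' := congrArg Multiplicative.toAdd h
  rw [toAdd_mul, toAdd_one] at h'
  exact congrArg Multiplicative.ofAdd (Nat.eq_zero_of_add_eq_zero_right h')

/-- `act f` induces an injection on characteristics: `(g, a) ~ (g', a')` iff `a = a'`, and `d_f · a = d_f · a'`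
forces `a = a'`. [cite: MochizukiFrdI2008, Ex. 3.7 p.70] -/
theorem associatesMap_act_injective (f : FG) : Function.Injective (associatesMap (Literature.AlgebraicGeometry.Frobenioids.Ex37.act f)) := by
  intro x y hxy
  obtain ⟨a, rfl⟩ := Associates.mk_surjective x
  obtain ⟨b, rfl⟩ := Associates.mk_surjective y
  rw [associatesMap_mk, associatesMap_mk, Associates.mk_eq_mk_iff_associated] at hxy
  obtain ⟨u, hu⟩ := hxy
  have hu2 : (u : Multiplicative G × Multiplicative ℕ).2 = 1 := snd_eq_one_of_isUnit u.isUnit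
  have h2 : a.2 ^ (f.degFr : ℕ) = b.2 ^ (f.degFr : ℕ) := by
    have := congrArg Prod.snd hu
    rw [act_apply, act_apply, Prod.snd_mul, hu2, mul_one] at this
    exact this
  have hab : a.2 = b.2 := pow_injective_multiplicativeNat f.degFr h2
  rw [Associates.mk_eq_mk_iff_associated]
  refine ⟨⟨(a.1⁻¹ * b.1, 1), (b.1⁻¹ * a.1, 1), ?_, ?_⟩, ?_⟩
  · exact Prod.ext (by rw [Prod.fst_mul, Prod.fst_one]; group) (mul_one _)
  · exact Prod.ext (by rw [Prod.fst_mul, Prod.fst_one]; group) (mul_one _)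
  · show a * (a.1⁻¹ * b.1, 1) = b
    refine Prod.ext ?_ ?_
    · show a.1 * (a.1⁻¹ * b.1) = b.1
      rw [mul_inv_cancel_left]
    · show a.2 * 1 = b.2
      rw [mul_one, hab]

/-- The isomorphisms of `D = B(F_G)` are the elements of Frobenius degree `1`; these act trivially.
[cite: MochizukiFrdI2008, Ex. 3.7 p.70] -/
theorem act_eq_id_of_isIso {X Y : D} (f : Y ⟶ X) (hf : IsIso f) :
    Literature.AlgebraicGeometry.Frobenioids.Ex37.act (show FG from f) = MonoidHom.id _ := by
  have h1 : (show FG from f).degFr = 1 :=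
    (isUnit_iff_degFr_eq_one _).mp ((SingleObj.isIso_iff_isUnit f).mp hf)
  refine MonoidHom.ext fun x => ?_
  rw [act_apply, h1, PNat.one_coe, pow_one, MonoidHom.id_apply]

/-- **Example 3.7**: `Φ = G × ℤ_{≥0}` is a monoid on `D` (Def. 1.1 (ii): (a) the pull-backs `act f` are
characteristically injective; (b) an FSM-morphism of `D` is an isomorphism (`Ex36.isOfFSMType`), of Frobenius
degree `1`, so it acts bijectively). [cite: MochizukiFrdI2008, Ex. 3.7 p.70] -/
theorem isMonoidOn_Φ : IsMonoidOn Literature.AlgebraicGeometry.Frobenioids.Ex37.Φ where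
  isCharInjective f := ⟨act_injective' _, associatesMap_act_injective _⟩
  bijective_of_isFSM f hf := by
    show Function.Bijective (act (show FG from f))
    rw [act_eq_id_of_isIso f (Ex36.isOfFSMType.isIso_of_isFSM f hf)]
    exact Function.bijective_id

/-- `Φ = G × ℤ_{≥0}` is (objectwise) pre-divisorial (a product of the group-like `G` and the pre-divisorial
`ℤ_{≥0}`). [cite: MochizukiFrdI2008, Ex. 3.7 p.70] -/
theorem objectwise_isPreDivisorial_Φ : Objectwise (fun N _ => IsPreDivisorial N) Literature.AlgebraicGeometry.Frobenioids.Ex37.Φ :=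
  fun _ => (isGroupLike_of_commGroup (Multiplicative G)).isPreDivisorial.prod
    StandardFrobenioidExample.isPreDivisorial_M

/-- **Example 3.7**: "`C := F_Φ`. Thus, `C` is a Frobenioid" — `F_Φ → F_{Φ^char}` is a Frobenioid (Prop. 1.5 (i)).
[cite: MochizukiFrdI2008, Ex. 3.7 p.70] -/
theorem isFrobenioid : PreFrobenioid.IsFrobenioid (ElemFrobenioid.toChar Literature.AlgebraicGeometry.Frobenioids.Ex37.Φ) :=
  ElemFrobenioid.isFrobenioid_toChar isMonoidOn_Φ objectwise_isPreDivisorial_Φ (isGraphConnected_singleObj FG)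
    (isTotallyEpimorphic_singleObj_elemFrobenioidMonoid (Multiplicative G))

/-- **Example 3.7**: "… of Frobenius-normalized … type" (Prop. 1.5 (i)). [cite: MochizukiFrdI2008, Ex. 3.7 p.70] -/
theorem isOfType_isFrobeniusNormalized :
    PreFrobenioid.IsOfType (PreFrobenioid.IsFrobeniusNormalized (ElemFrobenioid.toChar Literature.AlgebraicGeometry.Frobenioids.Ex37.Φ)) :=
  fun A => ElemFrobenioid.isFrobeniusNormalized A

/-- **Example 3.7**: "… and isotropic type" (Prop. 1.5 (i)). [cite: MochizukiFrdI2008, Ex. 3.7 p.70] -/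
theorem isOfIsotropicType : PreFrobenioid.IsOfIsotropicType (ElemFrobenioid.toChar Literature.AlgebraicGeometry.Frobenioids.Ex37.Φ) :=
  fun A => ElemFrobenioid.isIsotropic A

/-- **Example 3.7**: "… which is not of group-like type [cf. Proposition 1.5, (i), (ii)]" — the class of
`(0, 1) ∈ G × ℤ_{≥0}` in `Φ^char` is not trivial, so the unique object is not group-like.
[cite: MochizukiFrdI2008, Ex. 3.7 p.70] -/
theorem not_isOfType_isGroupLikeObj :
    ¬ PreFrobenioid.IsOfType (PreFrobenioid.IsGroupLikeObj (ElemFrobenioid.toChar Literature.AlgebraicGeometry.Frobenioids.Ex37.Φ)) := by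
  intro h
  have h1 : Associates.mk (((1 : Multiplicative G), Multiplicative.ofAdd (1 : ℕ)) :
      Multiplicative G × Multiplicative ℕ) = 1 := h obj _
  rw [Associates.mk_eq_one] at h1
  have h2 := snd_eq_one_of_isUnit h1
  exact absurd (congrArg Multiplicative.toAdd h2) (by simp)

end Ex37

end Literature.AlgebraicGeometry.Frobenioids
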